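import Summits.MatrixMultiplication.MatrixMultiplication.Theorems.SoloInformedTwistedMatchingsAbelian
import HarnessLib

/-!
# Effective Theorem B″ for elementary abelian hosts: the Ellenberg–Gijswijt constant, twisted

Solo-informed seat (MatrixMultiplication), gen 101; sharpest-statement §2y(7)(B)/(8).
`twistedMatching_card_le_effective`: for a prime `p`, a finite abelian group `S` of exponent `p` with
`|S| = p^k`, ANY finite family of automorphism pairs `(φ_s, ψ_s)`, any twisted matching
`(∃ s, x_i φ_s(y_j) ψ_s(z_l) = 1) ⟺ i = j = l`, and every real `0 < u ≤ 1`: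
`|ι| ≤ 3 · (u^{-(p-1)/3} · Σ_{j<p} u^j)^k`.
Optimising `u` gives the Ellenberg–Gijswijt / BCCGNSU17 constant: `|ι| ≤ 3·(1.88988)^k = 3·(2^{0.9183})^k`
for `p = 2` (`u = 1/2`: `2^{1/3}·3/2`), `|ι| ≤ 3·(2.7551)^k = 3·(3^{0.9225})^k` for `p = 3`; in general
`inf_u θ_p(u) = p^{1-δ′_p}` with the seat's `δ′_2 = 0.0817`, `δ′_3 = 0.0775`, `δ′_p ~ 0.1727/log p`
(sharpest-statement §2y(7)) — so the twisted bound loses NOTHING against the untwisted tricolored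
sum-free bound, for every twist family, effectively. (The ineffective
`exists_abelianTwistedMatching_card_le` covers exponent `p^E`; here `E = 1` and the count is done by the
generating-function trick `𝟙[s ≤ T] ≤ u^{s-T}`, `Σ_e u^{Σ e_a} = (Σ_j u^j)^k`, on both tails.)
References: EllenbergGijswijt2017; BlasiakChurchCohnGrochowNaslundSawinUmans2017 (arXiv:1605.06702) Thm 4.14;
Tao's slice-rank note (2016).
-/

noncomputable section

open scoped BigOperators
open Finset Literature.Combinatorics.Additive Literature.Barriers.MatrixMultiplication

namespace Summit.MatrixMultiplication.MatrixMultiplication.Theorems.TwistedSliceRank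

section Effective

/-- Counting by a generating function: if `1 ≤ u^{f e}` on `P`, then `#{e // P e} ≤ Σ_e u^{f e}`.
[folklore] -/
theorem card_subtype_le_sum_rpow {α : Type*} [Fintype α] (P : α → Prop) [DecidablePred P]
    (u : ℝ) (hu : 0 < u) (f : α → ℝ) (h : ∀ e, P e → 1 ≤ u ^ f e) :
    (Fintype.card {e // P e} : ℝ) ≤ ∑ e, u ^ f e := by
  rw [Fintype.card_subtype, Finset.card_filter, Nat.cast_sum]
  refine Finset.sum_le_sum fun e _ => ?_
  split_ifs with he
  · simpa using h e he
  · simpa using Real.rpow_nonneg hu.le (f e)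

/-- `Σ_{e : ι → Fin p} u^{c + ε Σ_a e_a} = u^c (Σ_{j<p} u^{ε j})^{|ι|}`. [folklore] -/
theorem sum_rpow_linear {ι : Type*} [Fintype ι] [DecidableEq ι] (p : ℕ) (u : ℝ) (hu : 0 < u)
    (c ε : ℝ) :
    ∑ e : ι → Fin p, u ^ (c + ε * ∑ a, ((e a : ℕ) : ℝ)) =
      u ^ c * (∑ j : Fin p, u ^ (ε * ((j : ℕ) : ℝ))) ^ Fintype.card ι := by
  have h1 : ∀ e : ι → Fin p, u ^ (c + ε * ∑ a, ((e a : ℕ) : ℝ)) =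
      u ^ c * ∏ a, u ^ (ε * ((e a : ℕ) : ℝ)) := by
    intro e
    rw [Real.rpow_add hu, Finset.mul_sum, Real.rpow_sum_of_pos hu]
  simp_rw [h1]
  rw [← Finset.mul_sum]
  congr 1
  rw [← Finset.card_univ, ← Finset.prod_const,
    Finset.prod_univ_sum (fun _ : ι => (Finset.univ : Finset (Fin p)))
      (fun _ j => u ^ (ε * ((j : ℕ) : ℝ))), Fintype.piFinset_univ]

/-- Reversal: `Σ_{j<p} u^{-j} = u^{-(p-1)} Σ_{j<p} u^{j}`. [folklore] -/
theorem sum_rpow_neg_eq (p : ℕ) (u : ℝ) (hu : 0 < u) :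
    ∑ j : Fin p, u ^ (-1 * ((j : ℕ) : ℝ)) =
      u ^ (-(((p - 1 : ℕ) : ℝ))) * ∑ j : Fin p, u ^ ((j : ℕ) : ℝ) := by
  rw [Finset.mul_sum, ← Equiv.sum_comp Fin.revPerm (fun j : Fin p => u ^ (-1 * ((j : ℕ) : ℝ)))]
  refine Finset.sum_congr rfl fun j _ => ?_
  rw [Fin.revPerm_apply, Fin.val_rev, ← Real.rpow_add hu]
  congr 1
  have hj : (j : ℕ) + 1 ≤ p := j.2
  have h1 : ((p - ((j : ℕ) + 1) : ℕ) : ℝ) = (p : ℝ) - ((j : ℕ) + 1) := by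
    rw [Nat.cast_sub hj]; push_cast; ring
  have h2 : (((p - 1 : ℕ)) : ℝ) = (p : ℝ) - 1 := by
    rw [Nat.cast_sub (by omega)]; push_cast; ring
  rw [h1, h2]; ring

/-- **Effective twisted Ellenberg–Gijswijt bound.** `p` prime, `S` abelian of exponent `p` with
`|S| = p^k`, any finite family of automorphism pairs, any twisted matching, any `0 < u ≤ 1`:
`|ι| ≤ 3 · (u^{-(p-1)/3} · Σ_{j<p} u^j)^k`. [this work] -/
theorem twistedMatching_card_le_effective (p : ℕ) [hp : Fact p.Prime] (S : Type) [CommGroup S]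
    [Fintype S] [DecidableEq S] (hexpS : ∀ g : S, g ^ p = 1) (k : ℕ)
    (hSk : Fintype.card S = p ^ k) (σ : Type) [Fintype σ] (φ ψ : σ → S ≃* S) (ι : Type)
    [Fintype ι] (x y z : ι → S)
    (hmatch : ∀ i j l : ι, (∃ s : σ, x i * φ s (y j) * ψ s (z l) = 1) ↔ (i = j ∧ j = l))
    (u : ℝ) (hu0 : 0 < u) (hu1 : u ≤ 1) :
    (Fintype.card ι : ℝ) ≤
      3 * (u ^ (-(((p - 1 : ℕ) : ℝ) / 3)) * ∑ j : Fin p, u ^ ((j : ℕ) : ℝ)) ^ k := by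
  classical
  have hp2 : 2 ≤ p := hp.out.two_le
  -- structure theorem: `S ≃* ∏_i ℤ/n_i`, `n_i = p^{e_i}`, `e_i ≤ 1`
  obtain ⟨κ, _, nn, hn1, ⟨eS⟩⟩ := CommGroup.equiv_prod_multiplicative_zmod_of_finite S
  haveI : ∀ i, NeZero (nn i) := fun i => ⟨by have := hn1 i; omega⟩
  have hex : ∀ i, ∃ m ≤ 1, nn i = p ^ m := by
    intro i
    refine (Nat.dvd_prime_pow hp.out).1 ((ZMod.natCast_eq_zero_iff _ _).1 ?_)
    have h1 := hexpS (eS.symm (Pi.mulSingle i (Multiplicative.ofAdd (1 : ZMod (nn i)))))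
    rw [← map_pow, eS.symm.map_eq_one_iff, ← Pi.mulSingle_pow, ← ofAdd_nsmul, nsmul_eq_mul,
      mul_one] at h1
    have h2 := congr_fun h1 i
    rw [Pi.mulSingle_eq_same, Pi.one_apply, ofAdd_eq_one, ← pow_one p] at h2
    exact h2
  choose e heE hne using hex
  obtain ⟨ιA, _, _, C, hCL, hS'⟩ := exists_prodZMod_levelPCGS (p := p) (n := nn) (e := e) hne heE
  -- all weights are `1`
  have hW : ∀ a : ιA, C.W a = 1 := by
    intro a
    show (p + 1) ^ C.lvl a = 1
    have h1 := C.lvl_lt a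
    rw [hCL] at h1
    rw [show C.lvl a = 0 by omega, pow_zero]
  -- `|ιA| = k`
  have hkA : Fintype.card ιA = k := by
    have h1 : Fintype.card S = p ^ Fintype.card ιA := by
      rw [Fintype.card_congr eS.toEquiv, ← Nat.card_eq_fintype_card, C.card_eq]
    exact (Nat.pow_right_injective hp2 (hSk.symm.trans h1)).symm
  -- transport the matching along `eS`
  let φ' := fun s => (eS.symm.trans (φ s)).trans eS
  let ψ' := fun s => (eS.symm.trans (ψ s)).trans eS
  have hrel : ∀ (i j l : ι) (s : σ),
      eS (x i) * φ' s (eS (y j)) * ψ' s (eS (z l)) = 1 ↔ x i * φ s (y j) * ψ s (z l) = 1 := by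
    intro i j l s
    simp only [φ', ψ', MulEquiv.trans_apply, MulEquiv.symm_apply_apply]
    rw [← map_mul, ← map_mul, eS.map_eq_one_iff]
  have hmatch' : ∀ i j l : ι,
      (∃ s : σ, eS (x i) * φ' s (eS (y j)) * ψ' s (eS (z l)) = 1) ↔ (i = j ∧ j = l) := by
    intro i j l
    simp_rw [hrel]
    exact hmatch i j l
  -- the field and the weights
  have hinj : Function.Injective
      (algebraMap (Polynomial (ZMod p)) (FractionRing (Polynomial (ZMod p)))) :=
    IsFractionRing.injective (Polynomial (ZMod p)) (FractionRing (Polynomial (ZMod p)))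
  haveI : CharP (FractionRing (Polynomial (ZMod p))) p := charP_of_injective_algebraMap hinj p
  haveI : Infinite (FractionRing (Polynomial (ZMod p))) := Infinite.of_injective _ hinj
  let Sol : ι → Finset σ := fun i => Finset.univ.filter fun s =>
    eS (x i) * φ' s (eS (y i)) * ψ' s (eS (z i)) = 1
  have hSol : ∀ i, (Sol i).Nonempty := fun i => by
    obtain ⟨s, hs⟩ := (hmatch' i i i).2 ⟨rfl, rfl⟩
    exact ⟨s, by simp [Sol, hs]⟩
  obtain ⟨t, ht⟩ := exists_weights (K := FractionRing (Polynomial (ZMod p))) Sol hSol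
  have hdiag : ∀ i, (∑ s, t s * (if eS (x i) * φ' s (eS (y i)) * ψ' s (eS (z i)) = 1
      then (1 : FractionRing (Polynomial (ZMod p))) else 0)) ≠ 0 := by
    intro i
    have hsum : (∑ s, t s * (if eS (x i) * φ' s (eS (y i)) * ψ' s (eS (z i)) = 1
        then (1 : FractionRing (Polynomial (ZMod p))) else 0)) = ∑ s ∈ Sol i, t s := by
      rw [Finset.sum_filter]
      exact Finset.sum_congr rfl fun s _ => by split_ifs <;> simp
    rw [hsum]
    exact ht i
  -- the slice-rank count with threshold `tt = ⌈(p-1)k/3⌉`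
  set M : ℕ := (p - 1) * k with hM
  set tt : ℕ := (M + 2) / 3 with htt
  have hcard := card_le_of_levelTwistedMatching C (K := FractionRing (Polynomial (ZMod p))) hS' t
    φ' ψ' (fun i => eS (x i)) (fun i => eS (y i)) (fun i => eS (z i))
    (fun i j l s h => (hmatch' i j l).1 ⟨s, h⟩) hdiag tt tt
  have hcard' : (Fintype.card ι : ℝ) ≤
      (Fintype.card {ex : ιA → Fin p // ∑ a, (ex a : ℕ) * C.W a < tt} : ℝ) +
      (Fintype.card {ex : ιA → Fin p // ∑ a, (ex a : ℕ) * C.W a < tt} : ℝ) +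
      (Fintype.card {ex : ιA → Fin p // tt + tt ≤ ∑ a, (ex a : ℕ) * C.W a} : ℝ) := by
    exact_mod_cast hcard
  -- every digit sum is `≤ M`
  have hsumle : ∀ ex : ιA → Fin p, ∑ a, (ex a : ℕ) ≤ M := by
    intro ex
    calc ∑ a, (ex a : ℕ) ≤ ∑ _a : ιA, (p - 1) := Finset.sum_le_sum fun a _ => by
            have := (ex a).2; omega
      _ = M := by rw [Finset.sum_const, Finset.card_univ, smul_eq_mul, hkA, hM, mul_comm]
  set θ : ℝ := u ^ (-(((p - 1 : ℕ) : ℝ) / 3)) * ∑ j : Fin p, u ^ ((j : ℕ) : ℝ) with hθ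
  have hMreal : (M : ℝ) = ((p - 1 : ℕ) : ℝ) * k := by rw [hM]; push_cast; ring
  have hθk : θ ^ k = u ^ (-((M : ℝ) / 3)) * (∑ j : Fin p, u ^ ((j : ℕ) : ℝ)) ^ k := by
    rw [hθ, mul_pow, ← Real.rpow_natCast (u ^ _) k, ← Real.rpow_mul hu0.le, hMreal]
    congr 2; ring
  -- lower tail
  have hlow : (Fintype.card {ex : ιA → Fin p // ∑ a, (ex a : ℕ) * C.W a < tt} : ℝ) ≤ θ ^ k := by
    have h1 := card_subtype_le_sum_rpow (fun ex : ιA → Fin p => ∑ a, (ex a : ℕ) * C.W a < tt)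
      u hu0 (fun ex => -((M : ℝ) / 3) + 1 * ∑ a, ((ex a : ℕ) : ℝ)) (fun ex hex => by
        refine Real.one_le_rpow_of_pos_of_le_one_of_nonpos hu0 hu1 ?_
        simp_rw [hW, mul_one] at hex
        have h3 : 3 * ∑ a, (ex a : ℕ) ≤ M := by omega
        have h4 : (3 : ℝ) * ∑ a, ((ex a : ℕ) : ℝ) ≤ M := by exact_mod_cast h3
        linarith)
    refine h1.trans (le_of_eq ?_)
    rw [sum_rpow_linear p u hu0, hkA, hθk]
    simp only [one_mul]
  -- upper tail
  have hhigh : (Fintype.card {ex : ιA → Fin p // tt + tt ≤ ∑ a, (ex a : ℕ) * C.W a} : ℝ) ≤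
      θ ^ k := by
    have h1 := card_subtype_le_sum_rpow
      (fun ex : ιA → Fin p => tt + tt ≤ ∑ a, (ex a : ℕ) * C.W a)
      u hu0 (fun ex => 2 * (M : ℝ) / 3 + (-1) * ∑ a, ((ex a : ℕ) : ℝ)) (fun ex hex => by
        refine Real.one_le_rpow_of_pos_of_le_one_of_nonpos hu0 hu1 ?_
        simp_rw [hW, mul_one] at hex
        have h3 : 2 * M ≤ 3 * ∑ a, (ex a : ℕ) := by omega
        have h4 : (2 : ℝ) * M ≤ 3 * ∑ a, ((ex a : ℕ) : ℝ) := by exact_mod_cast h3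
        linarith)
    refine h1.trans (le_of_eq ?_)
    rw [sum_rpow_linear p u hu0, hkA, sum_rpow_neg_eq p u hu0, mul_pow, ← mul_assoc,
      ← Real.rpow_natCast (u ^ _) k, ← Real.rpow_mul hu0.le, ← Real.rpow_add hu0, hθk, hMreal]
    congr 2; ring
  calc (Fintype.card ι : ℝ) ≤ _ := hcard'
    _ ≤ θ ^ k + θ ^ k + θ ^ k := by gcongr
    _ = 3 * θ ^ k := by ring

end Effective

end Summit.MatrixMultiplication.MatrixMultiplication.Theorems.TwistedSliceRank
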